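import Summits.Ventures.PercRepro.RankLevelSetLevelFiveCqFifteenSix
import Summits.Ventures.PercRepro.S2FourteenEleven

/-!
# PercRepro — S2: THEOREM C₅ AT `15` MODULO THE FIVE CELLS `(14, 6 … 10)` (p1, gen 30, feeder for sub-claim S2; the `p = 14` row)

p7's `c025_five_large_sharp15_of_six_cells` with the cell `(14, 11)` discharged by `c025_core_five_fourteen_eleven` (the exact `s₄` cap):
**`c025_five_large_sharp15_of_five_cells (hfive : the cells (14, 6 … 10)) (M) (p) (hp : 15 ≤ p) : RLS M p 5`** — C-025 at level `5` for every
`p ≥ 15` MODULO the five cells `(14, 6 … 10)`. The window is NOT moved by this file. Axioms: standard.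
-/

open scoped Matroid

namespace PercRepro

namespace ThmN

variable {α : Type}

/-- **THEOREM C₅ AT `15` MODULO THE FIVE CELLS** `(14, 6 … 10)`: the sixth, `(14, 11)`, is `c025_core_five_fourteen_eleven`. -/
theorem c025_five_large_sharp15_of_five_cells
    (hfive : ∀ (M : Matroid α) [M.Finite] (d : ℕ), 6 ≤ d → d ≤ 10 → M.eRank = ((14 : ℕ) : ℕ∞) →
      M.E.ncard = 14 + d →
      (∀ e ∈ M.E, ∃ A ⊆ M.E \ {e}, e ∉ M.closure A ∧ e ∉ M.closure ((M.E \ {e}) \ A)) → RLS M 14 5)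
    (M : Matroid α) [M.Finite] (p : ℕ) (hp : 15 ≤ p) : RLS M p 5 := by
  refine c025_five_large_sharp15_of_six_cells ?_ M p hp
  intro M _ d hd6 hd11 hR hn hfree
  rcases Nat.lt_or_ge d 11 with h | h
  · exact hfive M d hd6 (by omega) hR hn hfree
  · obtain rfl : d = 11 := by omega
    exact c025_core_five_fourteen_eleven M hR hn hfree

end ThmN

end PercRepro
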